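import Literature.AlgebraicGeometry.ShimuraVarieties.UnitaryAuxiliaryTorusDatum
import Literature.AlgebraicGeometry.Motives.AbelianVarietyBaseChangeTower
import Literature.AlgebraicGeometry.Motives.BaseChangeTowerMonoidalOfFst
import Literature.AlgebraicGeometry.Motives.ComplexPointsGaloisUnderlying
import HarnessLib

/-!
# Complex points through a tower `ℚ ⊂ E ⊂ ℂ`: the `E`-form `X ⊗_ℚ E` of a `ℚ`-scheme and the two Galois actions
# (Milne, *Introduction to Shimura varieties*, §13 p. 117; Görtz–Wedhorn I, Prop. 4.16)

Topic `Literature/AlgebraicGeometry/Motives`, namespace `Literature.AlgebraicGeometry.Motives`.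
Cell `hodgecm-mathlib`, fan B-III (T3) = binder I-1′ (`canonicalModel_exists_printed`, item 24835), B-plan2's leaf
**T3-L1 «TowerTransport»** (statement file `B-plan/leaves/T3-L1-TowerTransport.statement.lean` 99ef79e2, consumed by
the v4 head `ambientReceptacle_of` of `Cruxes/HDel/Lines/F1ExtHodgeType.lean`).  Banked Motives leaf; no floor change.

For a `ℚ`-scheme `X` and a subfield `E ⊂ ℂ` (`E : IntermediateField ℚ ℂ`) put `A := X ⊗_ℚ E`
(`(Motives.baseChange ℚ ↥E).obj X`, the receptacle-to-be).  This file provides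

* `towerIso E X : (A ⊗_E ℂ) ≅ X ⊗_ℚ ℂ` — the tree's tower isomorphism `AbelianVariety.bcFunctorTowerIso ℚ E ℂ` at `X`;
* `towerPointEquiv E X : X(ℂ) ≃ A(ℂ)` — complex points of `X` (over `ℚ`) as complex points of its `E`-form `A` (over
  `E`), read through `Aux.pointsOfForm A` and `towerIso`; characterised by `towerPointEquiv_left_comp_fst`: the
  `E`-point `towerPointEquiv E X P` of `A = X ×_ℚ Spec E` is the one lying over the `ℚ`-point `P`;
* (T-b) `towerPointEquiv_smul` — **equivariance**: `Aut(ℂ/E) ⊂ Aut(ℂ/ℚ)` acts on `A(ℂ)` through the `E`-structure as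
  on `X(ℂ)` through the `ℚ`-structure: `towerPointEquiv E X ((σ.restrictScalars ℚ) • P) = σ • towerPointEquiv E X P`;
* (T-c) `towerPointEquiv_map` — **naturality** in `X`.

All statements are B-plan2's shapes verbatim.  Proofs: both sides of (T-b)/(T-c) are `E`-points of the fibre product
`X ×_{Spec ℚ} Spec E`, so they agree once they agree after the two projections; the first projection is computed by
`towerPointEquiv_left_comp_fst` (from the tree's ★ `bcFunctorTowerIso_hom_app_left_comp_fst` and
★ `AlgPoints.baseChangeEquiv_apply_left_comp_fst`), the second is the structure map of any `E`-point (`Over.w`).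

## References
* [Milne2005ShimuraVarieties] J. S. Milne, *Introduction to Shimura varieties* (2005), §13 p. 117 («the action of
  `Aut(Ω/k)` on `V(Ω)`»), §12 Def. 12.8.
* [GortzWedhorn2020] U. Görtz, T. Wedhorn, *Algebraic Geometry I*, 2nd ed., Prop. 4.16 and §(4.7) (transitivity of base
  change), §(14.20).
-/

set_option autoImplicit false
set_option backward.isDefEq.respectTransparency false

noncomputable section

open CategoryTheory CategoryTheory.Limits AlgebraicGeometry
open Literature.AlgebraicGeometry.ShimuraVarieties.UnitaryCanonicalModel

namespace Literature.AlgebraicGeometry.Motives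

variable (E : IntermediateField ℚ ℂ) (X : SchemeOver ℚ)

/-- **The tower isomorphism `(X ⊗_ℚ E) ⊗_E ℂ ≅ X ⊗_ℚ ℂ`** at a `ℚ`-scheme `X`: the component at `X` of the tree's
`AbelianVariety.bcFunctorTowerIso ℚ E ℂ` (transitivity of base change). [cite: GortzWedhorn2020, Prop. 4.16 and §(4.7)] -/
def towerIso : (Motives.baseChange ↥E ℂ).obj ((Motives.baseChange ℚ ↥E).obj X) ≅ (Motives.baseChange ℚ ℂ).obj X :=
  (AbelianVariety.bcFunctorTowerIso ℚ ↥E ℂ).app X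

/-- **Complex points of `X / ℚ` as complex points of the `E`-form `A := X ⊗_ℚ E`**: `X(ℂ) ≃ (X ⊗_ℚ ℂ)(ℂ)` over `ℂ`
(`AlgPoints.baseChangeEquiv`), then along `towerIso⁻¹` to `((X ⊗_ℚ E) ⊗_E ℂ)(ℂ)`, then back to `E`-rational complex
points of `A` by `(Aux.pointsOfForm A)⁻¹` ([Milne2005ShimuraVarieties] §13 p. 117: points of `V` over `Ω` read through a
model). [cite: Milne2005ShimuraVarieties, §13 p. 117 (the action of Aut(Ω/k) on V(Ω))] -/
def towerPointEquiv : ComplexPoints X ≃ ComplexPoints ((Motives.baseChange ℚ ↥E).obj X) :=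
  ((AlgPoints.baseChangeEquiv (algebraMap ℚ ℂ) X).trans
      ((Iso.refl (specOver ℂ ℂ)).homCongr (towerIso E X).symm)).trans
    (Aux.pointsOfForm ((Motives.baseChange ℚ ↥E).obj X)).symm

/-! ### The characterisation: `towerPointEquiv E X P` lies over `P` -/

/-- `towerPointEquiv` read through the form: `pointsOfForm A (towerPointEquiv E X P)` is the point `(P, 1)` of
`X ⊗_ℚ ℂ` carried along `towerIso⁻¹ : X ⊗_ℚ ℂ ⟶ (X ⊗_ℚ E) ⊗_E ℂ` — the normal form `AlgPoints.map (towerIso E X).inv _` that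
`ReciprocityThrough`-type consumers split with `AlgPoints.map_comp`. [cite: Milne2005ShimuraVarieties, §13 p. 117] -/
theorem pointsOfForm_towerPointEquiv (P : ComplexPoints X) :
    Aux.pointsOfForm ((Motives.baseChange ℚ ↥E).obj X) (towerPointEquiv E X P) =
      AlgPoints.map (towerIso E X).inv (AlgPoints.baseChangeEquiv (algebraMap ℚ ℂ) X P) := by
  rw [towerPointEquiv, Equiv.trans_apply, Equiv.trans_apply, Equiv.apply_symm_apply, Iso.homCongr_apply,
    Iso.refl_inv, Category.id_comp, Iso.symm_hom]
  rfl

/-- Unfolding `towerPointEquiv`: `X(ℂ) → (X ⊗_ℚ ℂ)(ℂ) → ((X ⊗_ℚ E) ⊗_E ℂ)(ℂ) → (X ⊗_ℚ E)(ℂ)` (the defining composite,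
as an equation of points; use `pointsOfForm_towerPointEquiv` for the `AlgPoints.map` normal form).
[cite: Milne2005ShimuraVarieties, §13 p. 117] -/
theorem towerPointEquiv_apply (P : ComplexPoints X) :
    towerPointEquiv E X P =
      (Aux.pointsOfForm ((Motives.baseChange ℚ ↥E).obj X)).symm
        (((Iso.refl (specOver ℂ ℂ)).homCongr (towerIso E X).symm)
          (AlgPoints.baseChangeEquiv (algebraMap ℚ ℂ) X P)) := by
  apply (Aux.pointsOfForm ((Motives.baseChange ℚ ↥E).obj X)).injective
  rw [pointsOfForm_towerPointEquiv, Equiv.apply_symm_apply, Iso.homCongr_apply, Iso.refl_inv,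
    Category.id_comp, Iso.symm_hom]
  rfl

/-- The inverse of the tower isomorphism lies over the first projections:
`e⁻¹ ≫ pr_{A, E→ℂ} ≫ pr_{X, ℚ→E} = pr_{X, ℚ→ℂ}` (from ★ `bcFunctorTowerIso_hom_app_left_comp_fst`).
[cite: GortzWedhorn2020, Prop. 4.16 and §(4.7)] -/
theorem towerIso_inv_left_comp_fst_comp_fst :
    (towerIso E X).inv.left ≫
        pullback.fst ((AbelianVariety.bcFunctor ℚ ↥E).obj X).hom (AbelianVariety.bcSpec ↥E ℂ) ≫
          pullback.fst X.hom (AbelianVariety.bcSpec ℚ ↥E) =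
      pullback.fst X.hom (AbelianVariety.bcSpec ℚ ℂ) := by
  -- fold the component of the natural isomorphism into `towerIso` SYNTACTICALLY (`Iso.app_hom`), so that the kernel
  -- never unfolds `bcFunctorTowerIso` under `.hom.app` (cf. the kernel note of `BaseChangeTowerFst`)
  have e1 : towerIso E X = (AbelianVariety.bcFunctorTowerIso ℚ ↥E ℂ).app X := rfl
  have e2 : (towerIso E X).hom = (AbelianVariety.bcFunctorTowerIso ℚ ↥E ℂ).hom.app X := by
    rw [e1, Iso.app_hom]
  have h : (towerIso E X).hom.left ≫ pullback.fst X.hom (AbelianVariety.bcSpec ℚ ℂ) =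
      pullback.fst ((AbelianVariety.bcFunctor ℚ ↥E).obj X).hom (AbelianVariety.bcSpec ↥E ℂ) ≫
        pullback.fst X.hom (AbelianVariety.bcSpec ℚ ↥E) := by
    rw [e2]
    exact AbelianVariety.bcFunctorTowerIso_hom_app_left_comp_fst ℚ ↥E ℂ X
  have hid : (towerIso E X).inv.left ≫ (towerIso E X).hom.left = 𝟙 ((Motives.baseChange ℚ ℂ).obj X).left := by
    rw [← Over.comp_left, (towerIso E X).inv_hom_id, Over.id_left]
  calc (towerIso E X).inv.left ≫
        pullback.fst ((AbelianVariety.bcFunctor ℚ ↥E).obj X).hom (AbelianVariety.bcSpec ↥E ℂ) ≫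
          pullback.fst X.hom (AbelianVariety.bcSpec ℚ ↥E)
      = (towerIso E X).inv.left ≫ (towerIso E X).hom.left ≫ pullback.fst X.hom (AbelianVariety.bcSpec ℚ ℂ) :=
        congrArg (fun t => (towerIso E X).inv.left ≫ t) h.symm
    _ = ((towerIso E X).inv.left ≫ (towerIso E X).hom.left) ≫ pullback.fst X.hom (AbelianVariety.bcSpec ℚ ℂ) :=
        (Category.assoc _ _ _).symm
    _ = 𝟙 ((Motives.baseChange ℚ ℂ).obj X).left ≫ pullback.fst X.hom (AbelianVariety.bcSpec ℚ ℂ) := by rw [hid]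
    _ = pullback.fst X.hom (AbelianVariety.bcSpec ℚ ℂ) := Category.id_comp _

/-- **`towerPointEquiv E X P` is the `E`-point of `A = X ×_{Spec ℚ} Spec E` lying over the `ℚ`-point `P`**: its
underlying morphism followed by the projection `A ⟶ X` is `P` (the second projection being the structure map
`Spec ℂ ⟶ Spec E` of any `E`-point). [cite: Milne2005ShimuraVarieties, §13 p. 117] -/
theorem towerPointEquiv_left_comp_fst (P : ComplexPoints X) :
    (towerPointEquiv E X P).left ≫ pullback.fst X.hom (AbelianVariety.bcSpec ℚ ↥E) = P.left := by
  rw [towerPointEquiv, Equiv.trans_apply, Equiv.trans_apply]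
  -- the inverse of `pointsOfForm` composes with the first projection `A ⊗_E ℂ ⟶ A`
  unfold Aux.pointsOfForm
  erw [AlgPoints.baseChangeEquiv_symm_apply_left]
  -- unfold `homCongr`: `R = 𝟙 ≫ B ≫ towerIso⁻¹`
  rw [Iso.homCongr_apply, Iso.refl_inv, Category.id_comp, Iso.symm_hom]
  erw [Over.comp_left, Category.assoc, Category.assoc]
  erw [towerIso_inv_left_comp_fst_comp_fst E X]
  exact AlgPoints.baseChangeEquiv_apply_left_comp_fst (algebraMap ℚ ℂ) X P

/-- Two `E`-points of `A = X ⊗_ℚ E` with the same image in `X` are equal (universal property of the fibre product;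
the second projections agree as structure maps). [cite: GortzWedhorn2020, Prop. 4.16 and §(4.7)] -/
theorem ext_of_left_comp_fst_eq {Q Q' : ComplexPoints ((Motives.baseChange ℚ ↥E).obj X)}
    (h : Q.left ≫ pullback.fst X.hom (AbelianVariety.bcSpec ℚ ↥E) =
      Q'.left ≫ pullback.fst X.hom (AbelianVariety.bcSpec ℚ ↥E)) : Q = Q' := by
  ext : 1
  apply pullback.hom_ext
  · exact h
  · exact (Over.w Q).trans (Over.w Q').symm

/-! ### (T-b) Equivariance and (T-c) naturality -/

/-- **(T-b) Equivariance of `towerPointEquiv` under `Aut(ℂ/E) ⊂ Aut(ℂ/ℚ)`**: for `σ ∈ Aut(ℂ/E)` and `P ∈ X(ℂ)`,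
`towerPointEquiv E X ((σ|_ℚ) • P) = σ • towerPointEquiv E X P` — `Aut(ℂ/E)` acts on `A(ℂ)` through the `E`-structure
as on `X(ℂ)` through the `ℚ`-structure (LEFT actions `σ • P = Spec σ ≫ P`; both sides lie over `Spec σ ≫ P`).
[cite: Milne2005ShimuraVarieties, §13 p. 117 (the action of Aut(Ω/k) on V(Ω))] -/
theorem towerPointEquiv_smul (σ : ℂ ≃ₐ[↥E] ℂ) (P : ComplexPoints X) :
    towerPointEquiv E X ((σ.restrictScalars ℚ) • P) = σ • towerPointEquiv E X P := by
  apply ext_of_left_comp_fst_eq E X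
  calc (towerPointEquiv E X ((σ.restrictScalars ℚ) • P)).left ≫ pullback.fst X.hom (AbelianVariety.bcSpec ℚ ↥E)
      = ((σ.restrictScalars ℚ) • P).left := towerPointEquiv_left_comp_fst E X _
    _ = Spec.map (CommRingCat.ofHom (σ : ℂ →+* ℂ)) ≫ P.left := AlgPoints.smul_left _ P
    _ = Spec.map (CommRingCat.ofHom (σ : ℂ →+* ℂ)) ≫ ((towerPointEquiv E X P).left ≫
          pullback.fst X.hom (AbelianVariety.bcSpec ℚ ↥E)) :=
        congrArg (fun t => Spec.map (CommRingCat.ofHom (σ : ℂ →+* ℂ)) ≫ t)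
          (towerPointEquiv_left_comp_fst E X P).symm
    _ = (Spec.map (CommRingCat.ofHom (σ : ℂ →+* ℂ)) ≫ (towerPointEquiv E X P).left) ≫
          pullback.fst X.hom (AbelianVariety.bcSpec ℚ ↥E) := (Category.assoc _ _ _).symm
    _ = (σ • towerPointEquiv E X P).left ≫ pullback.fst X.hom (AbelianVariety.bcSpec ℚ ↥E) :=
        congrArg (fun t => t ≫ pullback.fst X.hom (AbelianVariety.bcSpec ℚ ↥E))
          (AlgPoints.smul_left σ (towerPointEquiv E X P)).symm

/-- **(T-c) Naturality of `towerPointEquiv` in `X`**: for a `ℚ`-morphism `f : X ⟶ Y` and `P ∈ X(ℂ)`,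
`towerPointEquiv E Y (f(P)) = (f ⊗_ℚ E) (towerPointEquiv E X P)` (both lie over `P ≫ f`).
[cite: GortzWedhorn2020, Prop. 4.16 and §(4.7)] -/
theorem towerPointEquiv_map {X Y : SchemeOver ℚ} (f : X ⟶ Y) (P : ComplexPoints X) :
    towerPointEquiv E Y (AlgPoints.map f P) =
      AlgPoints.map ((Motives.baseChange ℚ ↥E).map f) (towerPointEquiv E X P) := by
  apply ext_of_left_comp_fst_eq E Y
  calc (towerPointEquiv E Y (AlgPoints.map f P)).left ≫ pullback.fst Y.hom (AbelianVariety.bcSpec ℚ ↥E)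
      = (AlgPoints.map f P).left := towerPointEquiv_left_comp_fst E Y _
    _ = P.left ≫ f.left := rfl
    _ = ((towerPointEquiv E X P).left ≫ pullback.fst X.hom (AbelianVariety.bcSpec ℚ ↥E)) ≫ f.left :=
        congrArg (fun t => t ≫ f.left) (towerPointEquiv_left_comp_fst E X P).symm
    _ = (towerPointEquiv E X P).left ≫ (pullback.fst X.hom (AbelianVariety.bcSpec ℚ ↥E) ≫ f.left) :=
        Category.assoc _ _ _
    _ = (towerPointEquiv E X P).left ≫ (((Motives.baseChange ℚ ↥E).map f).left ≫
          pullback.fst Y.hom (AbelianVariety.bcSpec ℚ ↥E)) :=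
        congrArg (fun t => (towerPointEquiv E X P).left ≫ t)
          (baseChangeHom_map_left_comp_fst (algebraMap ℚ ↥E) f).symm
    _ = ((towerPointEquiv E X P).left ≫ ((Motives.baseChange ℚ ↥E).map f).left) ≫
          pullback.fst Y.hom (AbelianVariety.bcSpec ℚ ↥E) := (Category.assoc _ _ _).symm
    _ = (AlgPoints.map ((Motives.baseChange ℚ ↥E).map f) (towerPointEquiv E X P)).left ≫
          pullback.fst Y.hom (AbelianVariety.bcSpec ℚ ↥E) := rfl

end Literature.AlgebraicGeometry.Motives

end
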